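import Literature.Computability.Complexity.PCPOfGapE3SAT
import Literature.Computability.Complexity.ClayProblemProofs
import HarnessLib

/-!
# From a polynomial-time gap-producing map on 3CNF codes to `gapE3SAT` hardness and the PCP theorem

The last, purely complexity-theoretic, link of the tree's proof of the PCP theorem
(`pcp_theorem_exact`, Arora–Barak 2009, Thm. 11.5): "**qCSP is a generalization of 3SAT and is
NP-hard** … apply the function `f` obtained by Lemma 22.4 … we get a gap" (§22.2) followed by
"Theorem 11.14 implies Theorem 11.9 [GAP-3SAT hardness]" (§11.3.1) and the equivalence with PCPs
(`PCPOfGapE3SAT.lean`).  Given a **gap machine** — a string function `g ∈ FP` which maps the code of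
every CNF of width `≤ 3` to the code of an E3-CNF that is satisfiable if the input is and has value
`≤ 1 - ε₁` otherwise, and maps every other string to the code of the fixed no-instance `noE3`
(the eight sign patterns on three variables, value `7/8`) — the Cook–Levin theorem
(`isNPComplete_kSAT_three_holds`) and composition in `FP` (`comp_mem_FP`) give
`(gapE3SAT (1/8 - ε₁)).IsNPHard`, whence `pcp_theorem_exact` by `pcp_theorem_exact_of_gapE3SAT_isNPHard`.

* `noE3`, `isExactWidth_noE3`, `maxSatFraction_noE3_le` (`val = 7/8`);
* `GapMachine ε₁` (the hypothesis on the machine), **`gapE3SAT_isNPHard_of_gapMachine`**,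
  **`pcp_theorem_exact_of_gapMachine`**.

## References

* S. Arora, B. Barak, *Computational Complexity: A Modern Approach*, CUP 2009, §22.2 (proof of Thm.
  11.5), §11.3.1, Thm. 2.10 (Cook–Levin).
-/

namespace Literature.Computability.Complexity

open _root_.Computability

/-! ### The fixed no-instance -/

/-- **The fixed no-instance**: all eight sign patterns on the variables `0, 1, 2` (every assignment
falsifies exactly one clause, so `val = 7/8`). [cite: AroraBarakCC2009, §22.4 (the 7/8 threshold of E3SAT)] -/
def noE3 : CNF ℕ :=
  [[(0, false), (1, false), (2, false)], [(0, false), (1, false), (2, true)], [(0, false), (1, true), (2, false)],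
    [(0, false), (1, true), (2, true)], [(0, true), (1, false), (2, false)], [(0, true), (1, false), (2, true)],
    [(0, true), (1, true), (2, false)], [(0, true), (1, true), (2, true)]]

/-- `noE3` is an E3-CNF. [folklore] -/
theorem isExactWidth_noE3 : noE3.IsExactWidth 3 := by decide

/-- Every assignment satisfies exactly `7` of the `8` clauses of `noE3`. [folklore] -/
theorem countP_noE3 (σ : ℕ → Bool) : (noE3.countP fun c => Clause.eval σ c) = 7 := by
  cases h0 : σ 0 <;> cases h1 : σ 1 <;> cases h2 : σ 2 <;> simp [noE3, Clause.eval, Literal.eval, h0, h1, h2]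

/-- `val(noE3) ≤ 7/8`. [cite: AroraBarakCC2009, §22.4] -/
theorem maxSatFraction_noE3_le : noE3.maxSatFraction ≤ 7 / 8 := by
  classical
  unfold CNF.maxSatFraction
  refine Finset.sup'_le _ _ fun τ _ => ?_
  unfold CNF.satisfiedFraction CNF.numClauses
  have hlen : noE3.length = 8 := rfl
  rw [if_neg (by rw [hlen]; norm_num), countP_noE3, hlen]
  norm_num

/-! ### Gap machines -/

/-- A **gap machine** with gap `ε₁`: a polynomial-time string function mapping codes of CNFs of width
`≤ 3` to codes of E3-CNFs, satisfiable ones to satisfiable ones and unsatisfiable ones to ones of value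
`≤ 1 - ε₁`, and every other string to the code of `noE3`. [cite: AroraBarakCC2009, §22.2 (the map f of Lemma 22.4 iterated, then §11.3.1)] -/
structure GapMachine (ε₁ : ℚ) where
  /-- the string function -/
  g : List Bool → List Bool
  /-- it is polynomial-time -/
  g_mem : g ∈ FP
  /-- its behaviour on codes of 3CNFs -/
  spec : ∀ φ : CNF ℕ, φ.IsWidthLE 3 → ∃ ψ : CNF ℕ, g (encodingCNF.encode φ) = encodingCNF.encode ψ ∧ ψ.IsExactWidth 3 ∧
    (φ.Satisfiable → ψ.Satisfiable) ∧ (¬ φ.Satisfiable → ψ.maxSatFraction ≤ 1 - ε₁)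
  /-- its behaviour elsewhere -/
  junk : ∀ w : List Bool, (∀ φ : CNF ℕ, φ.IsWidthLE 3 → encodingCNF.encode φ ≠ w) → g w = encodingCNF.encode noE3

/-- **`gapE3SAT (1/8 - ε₁)` is NP-hard given a gap machine** (`0 < ε₁ ≤ 1/8`): compose the Cook–Levin
reduction to `3SAT` with the machine. [cite: AroraBarakCC2009, §22.2 and §11.3.1] -/
theorem gapE3SAT_isNPHard_of_gapMachine {ε₁ : ℚ} (M : GapMachine ε₁) (hε : ε₁ ≤ 1 / 8) :
    (gapE3SAT (1 / 8 - ε₁)).IsNPHard := by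
  intro L hL
  obtain ⟨r, hr, hspec⟩ := (isNPComplete_kSAT_three_holds).2 L hL
  refine ⟨M.g ∘ r, comp_mem_FP M.g_mem hr, fun x hx => ?_, fun x hx => ?_⟩
  · -- yes-instances: `r x` codes a satisfiable 3CNF
    have hrx : r x ∈ kSAT 3 := (hspec x).1 hx
    obtain ⟨φ, ⟨hw, hsat⟩, hφ⟩ := hrx
    obtain ⟨ψ, hg, hE3, hyes, -⟩ := M.spec φ hw
    show M.g (r x) ∈ (gapE3SAT (1 / 8 - ε₁)).yes
    rw [← hφ, hg, gapE3SAT_yes]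
    exact ⟨ψ, ⟨hE3, hyes hsat⟩, rfl⟩
  · -- no-instances
    have hrx : r x ∉ kSAT 3 := fun h => hx ((hspec x).2 h)
    show M.g (r x) ∈ (gapE3SAT (1 / 8 - ε₁)).no
    unfold gapE3SAT PromiseProblem.ofEncoding
    simp only
    by_cases hcode : ∃ φ : CNF ℕ, φ.IsWidthLE 3 ∧ encodingCNF.encode φ = r x
    · obtain ⟨φ, hw, hφ⟩ := hcode
      have hunsat : ¬ φ.Satisfiable := fun hs => hrx (hφ ▸ ⟨φ, ⟨hw, hs⟩, rfl⟩)
      obtain ⟨ψ, hg, hE3, -, hno⟩ := M.spec φ hw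
      rw [← hφ, hg]
      refine ⟨ψ, ⟨hE3, ?_⟩, rfl⟩
      linarith [hno hunsat]
    · push Not at hcode
      rw [M.junk (r x) fun φ hw => hcode φ hw]
      refine ⟨noE3, ⟨isExactWidth_noE3, ?_⟩, rfl⟩
      linarith [maxSatFraction_noE3_le]

/-- **The PCP theorem from a gap machine** (`0 < ε₁ ≤ 1/8`). [cite: AroraBarakCC2009, Thm. 11.5 (proof in §22.2)] -/
theorem pcp_theorem_exact_of_gapMachine {ε₁ : ℚ} (M : GapMachine ε₁) (hε0 : 0 < ε₁) (hε : ε₁ ≤ 1 / 8) : pcp_theorem_exact :=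
  pcp_theorem_exact_of_gapE3SAT_isNPHard (by linarith) (gapE3SAT_isNPHard_of_gapMachine M hε)

end Literature.Computability.Complexity
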